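import Mathlib.Analysis.InnerProductSpace.PiL2
import Literature.MathematicalPhysics.StatisticalMechanics.Theil2006PeriodicMinimumDistance
import Literature.MathematicalPhysics.StatisticalMechanics.Theil2006EnergyBounds
import HarnessLib

/-!
# Theil 2006, Corollary 1.3 — the relaxed Dirichlet energy `E(𝒜', {y})`, the minimum
distance (13) of its minimizers and their existence (§3, Proof of Corollary 1.3, p. 14)

Topic `Literature/MathematicalPhysics/StatisticalMechanics`; companion of `Theil2006.lean` (the
model: `IsAdmissible`, `IsClampedOutside`, `dirichletEnergy`, the named fact
`Theil2006_dirichletGroundStates` = Corollary 1.3), `Theil2006MinimumDistance.lean` (Lemma 2.2,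
the finite-`N` minimum distance (13), whose cell-counting machinery is reused here),
`Theil2006PeriodicMinimumDistance.lean` (Lemma 3.1, the same step of the proof of Theorem 1.2)
and `Theil2006EnergyBounds.lean` (the lattice `p`-series). Everything in this file is PROVED (no
`sorry`, no named fact introduced or discharged; D-0026); the three definitions have bodies.

## Source, as printed

F. Theil, *A proof of crystallization in two dimensions*, Comm. Math. Phys. **262** (2006)
209–236, §3, *Proof of Corollary 1.3* (read in the author's accepted preprint of 26 Aug 2005,
same numbering, p. 14; lit store `paper:url-69bff4ce1e30`):

"**Proof of Corollary 1.3.** Again we salvage the lower bound (13) by enlarging the set of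
competitors slightly. For `𝒜' ⊂ 𝒜` we set
`E(𝒜', {y}) = ∑_{{x,x'} ⊂ X, {x,x'} ∩ 𝒜' ≠ ∅} V(|y(x) − y(x')|)`,
where `X = (A₂ ∖ 𝒜) ∪ 𝒜'`. As before `E(𝒜', ·) = E_𝒜(·)` if `𝒜' = 𝒜`. Let `𝒜_min, y_min` be
the minimizer of `E(·, ·)`. Clearly `y_min` satisfies the bound (13) since the proof of Lemma 2.2
can be repeated for this case, word by word."

Here (Corollary 1.3, p. 3) `𝒜 ⊂ A₂` is "an arbitrary but finite set",
`E_𝒜({y}) := ∑_{{x,x'} ⊂ A₂, {x,x'} ∩ 𝒜 ≠ ∅} V(|y(x) − y(x')|)` subject to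
`y ∈ Y_𝒜^Dir = {y : A₂ → ℝ² | y(x) = x for all x ∈ A₂ ∖ 𝒜}` (`Theil2006.dirichletEnergy`,
`Theil2006.IsClampedOutside`), and (13) is the minimum-distance bound of Lemma 2.2 (p. 6),
`min_{x ≠ x'} |y(x) − y(x')| > 1 − α`. The proof of Lemma 2.2 being repeated (p. 6): "Define
`M := max_{η ∈ ℝ²} #(y(X) ∩ B(η, ½(1 − α)))`. The result is proven if we can show that `M = 1`.
[…] Set `B_M = B(0, ½(1 − α))` and `𝒜 = y⁻¹(B_M)`. By assumption (2) we have
`∑_{p ⊂ 𝒜, p ∈ 𝒫} e(p) ≥ (1/2α) M(M − 1)`. As we could move the positions `y(𝒜)` to infinity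
[here: remove them — the enlarged set of competitors] … we obtain the estimate (14)
`∑_{x ∈ 𝒜, x' ∈ X∖𝒜} e({x,x'}) ≤ −(1/2α) M(M − 1)`", followed by the ring count (15)–(17).

## What is here

* `Theil2006.relaxedDirichletEnergy V 𝒜 𝒜' y` — `E(𝒜', {y})` in the PRINTED (unordered)
  normalisation: the pairs inside `𝒜'` once each, plus the pairs with one point in `𝒜'` and the
  other in `A₂ ∖ 𝒜` (a `tsum`, a genuine sum for admissible `V`); the positions `y(x)`,
  `x ∈ 𝒜 ∖ 𝒜'`, of the removed particles do not enter. "As before `E(𝒜', ·) = E_𝒜(·)` if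
  `𝒜' = 𝒜`" is `Theil2006.relaxedDirichletEnergy_self` (definitionally), and `E(∅, ·) = 0`.
* `Theil2006.IsRelaxedDirichletMinimizer V 𝒜 𝒜' y` — "the minimizer of `E(·, ·)`": `𝒜' ⊆ 𝒜`,
  `y ∈ Y_𝒜^Dir`, and `E(𝒜', {y}) ≤ E(𝒜'', {y'})` for all `𝒜'' ⊆ 𝒜`, `y' ∈ Y_𝒜^Dir`.
* `Theil2006.relaxedDirichletEnergy_sub_sdiff` — the energy released by removing a set `𝒜''`
  of free particles: `E(𝒜', {y}) − E(𝒜' ∖ 𝒜'', {y}) = ∑_{x ∈ 𝒜''} (∑_{x' ∈ 𝒜'∖𝒜''} e +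
  ½ ∑_{x' ∈ 𝒜''∖{x}} e + ∑_{x' ∈ A₂∖𝒜} e)` (the left-hand side of (14) for this class).
* `Theil2006.exists_relaxedDirichletEnergy_lt` — **the mechanism of Lemma 2.2 in the relaxed
  Dirichlet class, for ANY competitor**: for `0 < α < 1/13447168` (the threshold of the tree's
  Lemma 2.2/3.1), `V` satisfying (1)–(5), `𝒜' ⊆ 𝒜` and `y ∈ Y_𝒜^Dir`, if two particles of
  `X = (A₂ ∖ 𝒜) ∪ 𝒜'` are at distance `≤ 1 − α`, then removing the free particles of a most
  crowded disc of radius `½(1 − α)` STRICTLY lowers `E`. (Stated for all `(𝒜', y)`, not only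
  for minimizers, because the same inequality drives the existence of the relaxed minimizer.)
* `Theil2006.IsRelaxedDirichletMinimizer.lt_dist`, `Theil2006.dirichletMinimumDistance` —
  **"Clearly `y_min` satisfies the bound (13)"**: every minimizer `(𝒜_min, y_min)` of `E(·,·)`
  has `|y_min(x) − y_min(x')| > 1 − α` for all `x ≠ x'` in `(A₂ ∖ 𝒜) ∪ 𝒜_min`. PROVED.
* `Theil2006.IsRelaxedDirichletMinimizer.dirichletEnergy_le`,
  `Theil2006.isRelaxedDirichletMinimizer_of_isMinOn` — the (implicit) transfer between the
  relaxed minimizer and the Dirichlet ground states of Corollary 1.3: a relaxed minimizer with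
  `𝒜_min = 𝒜` is a ground state of `E_𝒜` over `Y_𝒜^Dir`, and then every ground state of `E_𝒜`
  is a relaxed minimizer (so (13) applies to it).
* `Theil2006.exists_isRelaxedDirichletMinimizer` — **existence of "the minimizer of `E(·, ·)`",
  PROVED for admissible `V` that are continuous on `[0, ∞)`** (asserted in print without
  proof): removal confines the free particles to distance `≤ 1` from `𝒜`
  (`exists_subset_confined`: a free particle farther out is within `9/10` of a clamped site,
  `exists_dist_triPoint_le`), so every competitor is matched inside a compact box of free data
  (`clampedExtend`), on which `E(𝒜', {·})` is continuous
  (`continuous_relaxedDirichletEnergy_clampedExtend`, rows by dominated convergence: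
  `continuous_clampedRow`) for each of the finitely many `𝒜' ⊆ 𝒜`. With (13):
  `exists_isRelaxedDirichletMinimizer_lt_dist` — the first paragraph of the proof of
  Corollary 1.3 in full, for continuous admissible `V`.
* `Theil2006.IsRelaxedDirichletMinimizer.exists_dist_triPoint_le_one` — by (13), the free
  particles of a relaxed minimizer stay within distance `1` of `𝒜` (the input "we can assume
  that `A ⊂ B(0, C)`" of the periodization step, p. 14).

## Rendering notes

* **The competitor.** In the relaxed Dirichlet class the particles of the crowded disc are
  removed outright (`𝒜' ↦ 𝒜' ∖ 𝒜''`) instead of being "moved to infinity"; a clamped particle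
  `x ∈ A₂ ∖ 𝒜` cannot be removed, but two clamped particles are never in one disc of radius
  `½(1 − α) < ½` (points of `A₂` are `≥ 1` apart), so a crowded disc (`M ≥ 2`) always contains a
  free particle, and the (at most one) clamped particle in it is a companion at distance
  `≤ 1 − α`, priced `≥ 1/α` by (2) like the others. Per removed particle the released energy is
  `≥ (M − 1)/(2α) − 2WM` (`W = 4 · 420224`, the row constant of `Theil2006MinimumDistance.lean`:
  (11) near, (12) far, at most `M` particles per grid cell), positive for `M ≥ 2` and
  `α < 1/(8W) = 1/13447168`.
* As in `Theil2006MinimumDistance.lean`, summable cell weights replace the ring count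
  `n(k) ≤ CMk` of (15)–(17); the configuration `(A₂ ∖ 𝒜) ∪ 𝒜'` is locally finite and its rows
  `∑_{x'} V(|p − y(x')|)` converge (`IsClampedOutside.summable_row`, decay (12)).
* Existence of "the minimizer of `E(·, ·)`" is asserted in print without proof. We prove it
  for `V` continuous on `[0, ∞)`; the hypotheses (1)–(5) of `Theil2006.IsAdmissible`
  (real-valued `V`, `C²` on `(1 − α, ∞)`, only the inequality (2) on `[0, 1 − α]`) do not include
  continuity at `1 − α`, so for general admissible `V` the printed assertion stays a hypothesis
  downstream (as for the periodic problem in `Theil2006PeriodicLatticeStructure.lean`). The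
  remaining steps of the proof of Corollary 1.3 — periodization, (45)–(46) and the comparison
  with `E_L^per` via (44) — are separate bricks.
-/

noncomputable section

open scoped BigOperators Topology
open Filter Set Metric

namespace Literature.MathematicalPhysics.StatisticalMechanics

namespace Theil2006

/-! ### The relaxed Dirichlet energy `E(𝒜', {y})` and its minimizers (p. 14) -/

section Defs

variable {V : ℝ → ℝ} {A A' : Finset (ℤ × ℤ)} {y : ℤ × ℤ → Plane}

/-- **The relaxed Dirichlet energy** `E(𝒜', {y}) = ∑_{{x,x'} ⊂ X, {x,x'} ∩ 𝒜' ≠ ∅} V(|y(x) − y(x')|)`,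
`X = (A₂ ∖ 𝒜) ∪ 𝒜'`, of Theil 2006, §3, Proof of Corollary 1.3 (p. 14: "Again we salvage the
lower bound (13) by enlarging the set of competitors slightly. For `𝒜' ⊂ 𝒜` we set …"), for a
finite `𝒜 ⊂ A₂`, a set `𝒜' ⊆ 𝒜` of retained free particles and `y ∈ Y_𝒜^Dir`, in the printed
(unordered) normalisation of `dirichletEnergy`: the pairs inside `𝒜'` once each, plus every
`x ∈ 𝒜'` against all clamped `x' ∈ A₂ ∖ 𝒜` (a `tsum`). [cite: Theil2006, §3 Proof of Corollary 1.3 (preprint p. 14)] -/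
def relaxedDirichletEnergy (V : ℝ → ℝ) (A A' : Finset (ℤ × ℤ)) (y : ℤ × ℤ → Plane) : ℝ :=
  (∑ k ∈ A', ∑ k' ∈ A'.erase k, V (dist (y k) (y k'))) / 2 +
    ∑ k ∈ A', ∑' k' : {k' : ℤ × ℤ // k' ∉ A}, V (dist (y k) (y k'.1))

/-- "As before `E(𝒜', ·) = E_𝒜(·)` if `𝒜' = 𝒜`" (p. 14) — definitionally.
[cite: Theil2006, §3 Proof of Corollary 1.3 (preprint p. 14)] -/
theorem relaxedDirichletEnergy_self (V : ℝ → ℝ) (A : Finset (ℤ × ℤ)) (y : ℤ × ℤ → Plane) :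
    relaxedDirichletEnergy V A A y = dirichletEnergy V A y :=
  rfl

/-- Removing every free particle leaves no pair meeting `𝒜' = ∅`: `E(∅, {y}) = 0`.
[cite: Theil2006, §3 Proof of Corollary 1.3 (preprint p. 14)] -/
theorem relaxedDirichletEnergy_empty (V : ℝ → ℝ) (A : Finset (ℤ × ℤ)) (y : ℤ × ℤ → Plane) :
    relaxedDirichletEnergy V A ∅ y = 0 := by
  simp [relaxedDirichletEnergy]

/-- **Minimizers of the relaxed Dirichlet problem** (p. 14: "Let `𝒜_min, y_min` be the minimizer
of `E(·, ·)`"): `𝒜' ⊆ 𝒜`, `y ∈ Y_𝒜^Dir`, and `E(𝒜', {y}) ≤ E(𝒜'', {y'})` for every `𝒜'' ⊆ 𝒜` and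
every `y' ∈ Y_𝒜^Dir`. [cite: Theil2006, §3 Proof of Corollary 1.3 (preprint p. 14)] -/
def IsRelaxedDirichletMinimizer (V : ℝ → ℝ) (A A' : Finset (ℤ × ℤ)) (y : ℤ × ℤ → Plane) : Prop :=
  A' ⊆ A ∧ IsClampedOutside A y ∧
    ∀ (A'' : Finset (ℤ × ℤ)) (y' : ℤ × ℤ → Plane), A'' ⊆ A → IsClampedOutside A y' →
      relaxedDirichletEnergy V A A' y ≤ relaxedDirichletEnergy V A A'' y'

/-- A relaxed minimizer is in particular no worse than the undeformed lattice with all of `𝒜`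
retained, `E(𝒜', {y}) ≤ E_𝒜(A₂)` ("can be estimated by `E_𝒜(A₂)` due to the minimality of
`y_min`", p. 15). [cite: Theil2006, §3 Proof of Corollary 1.3 (preprint pp. 14–15)] -/
theorem IsRelaxedDirichletMinimizer.le_dirichletEnergy_triPoint
    (h : IsRelaxedDirichletMinimizer V A A' y) :
    relaxedDirichletEnergy V A A' y ≤ dirichletEnergy V A triPoint :=
  h.2.2 A triPoint (Finset.Subset.refl A) (isClampedOutside_triPoint A)

/-- A relaxed minimizer which retains all of `𝒜` is a ground state of `E_𝒜` over `Y_𝒜^Dir`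
(the competitors `(𝒜, y')`). [cite: Theil2006, §3 Proof of Corollary 1.3 (preprint p. 14)] -/
theorem IsRelaxedDirichletMinimizer.dirichletEnergy_le (h : IsRelaxedDirichletMinimizer V A A y)
    {y' : ℤ × ℤ → Plane} (hy' : IsClampedOutside A y') :
    dirichletEnergy V A y ≤ dirichletEnergy V A y' :=
  h.2.2 A y' (Finset.Subset.refl A) hy'

/-- **The transfer to arbitrary ground states.** If some relaxed minimizer retains all of `𝒜`
(`𝒜_min = 𝒜`, as the proof of Corollary 1.3 eventually shows), then every ground state `y` of
`E_𝒜` over `Y_𝒜^Dir` is itself a relaxed minimizer `(𝒜, y)` (so that (13) and the rest of the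
argument apply to it): `E(𝒜, {y}) = E_𝒜(y) ≤ E_𝒜(y₀) = E(𝒜, {y₀}) = min E(·, ·)`. The printed
text treats "the" minimizer; this is the implicit step. [cite: Theil2006, §3 Proof of Corollary 1.3 (preprint pp. 14–15)] -/
theorem isRelaxedDirichletMinimizer_of_isMinOn {y₀ : ℤ × ℤ → Plane}
    (h₀ : IsRelaxedDirichletMinimizer V A A y₀) (hy : IsClampedOutside A y)
    (hmin : ∀ y' : ℤ × ℤ → Plane, IsClampedOutside A y' →
      dirichletEnergy V A y ≤ dirichletEnergy V A y') :
    IsRelaxedDirichletMinimizer V A A y := by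
  refine ⟨Finset.Subset.refl A, hy, fun A'' y' hA'' hy' => ?_⟩
  calc relaxedDirichletEnergy V A A y = dirichletEnergy V A y := rfl
    _ ≤ dirichletEnergy V A y₀ := hmin y₀ h₀.2.1
    _ = relaxedDirichletEnergy V A A y₀ := rfl
    _ ≤ relaxedDirichletEnergy V A A'' y' := h₀.2.2 A'' y' hA'' hy'

end Defs

/-! ### Removing free particles: the energy released -/

section Difference

variable {V : ℝ → ℝ} {A : Finset (ℤ × ℤ)} {y : ℤ × ℤ → Plane}

/-- Splitting the (ordered, diagonal-free) pair sum of a disjoint union `B ⊔ C` for a symmetric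
kernel: pairs inside `B`, twice the mixed pairs, pairs inside `C`. [folklore] -/
private theorem sum_sum_erase_union {B C : Finset (ℤ × ℤ)} (h : Disjoint B C) (f : ℤ × ℤ → ℤ × ℤ → ℝ)
    (hf : ∀ a b, f a b = f b a) :
    ∑ k ∈ B ∪ C, ∑ k' ∈ (B ∪ C).erase k, f k k' =
      ∑ k ∈ B, ∑ k' ∈ B.erase k, f k k' + 2 * ∑ k ∈ C, ∑ k' ∈ B, f k k' +
        ∑ k ∈ C, ∑ k' ∈ C.erase k, f k k' := by
  classical
  rw [Finset.sum_union h]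
  have hB : ∀ k ∈ B, ∑ k' ∈ (B ∪ C).erase k, f k k' =
      ∑ k' ∈ B.erase k, f k k' + ∑ k' ∈ C, f k k' := by
    intro k hk
    have hkC : k ∉ C := Finset.disjoint_left.1 h hk
    rw [Finset.erase_union_distrib, Finset.erase_eq_of_notMem hkC,
      Finset.sum_union (Finset.disjoint_of_subset_left (B.erase_subset k) h)]
  have hC : ∀ k ∈ C, ∑ k' ∈ (B ∪ C).erase k, f k k' =
      ∑ k' ∈ B, f k k' + ∑ k' ∈ C.erase k, f k k' := by
    intro k hk
    have hkB : k ∉ B := Finset.disjoint_right.1 h hk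
    rw [Finset.erase_union_distrib, Finset.erase_eq_of_notMem hkB,
      Finset.sum_union (Finset.disjoint_of_subset_right (C.erase_subset k) h)]
  rw [Finset.sum_congr rfl hB, Finset.sum_congr rfl hC, Finset.sum_add_distrib,
    Finset.sum_add_distrib]
  have hsym : ∑ k ∈ B, ∑ k' ∈ C, f k k' = ∑ k ∈ C, ∑ k' ∈ B, f k k' := by
    rw [Finset.sum_comm]
    exact Finset.sum_congr rfl fun k _ => Finset.sum_congr rfl fun k' _ => hf _ _
  rw [hsym]
  ring

/-- **The energy released by removing free particles** (the left-hand side of (14) in the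
relaxed Dirichlet class): for `𝒜'' ⊆ 𝒜'`,
`E(𝒜', {y}) − E(𝒜' ∖ 𝒜'', {y}) = ∑_{x ∈ 𝒜''} (∑_{x' ∈ 𝒜'∖𝒜''} e({x,x'}) +
½ ∑_{x' ∈ 𝒜''∖{x}} e({x,x'}) + ∑_{x' ∈ A₂∖𝒜} e({x,x'}))` — every pair of `X` meeting `𝒜''`
exactly once. [cite: Theil2006, §2.2 proof of Lemma 2.2 (14) (preprint p. 6); §3 Proof of Corollary 1.3 (p. 14)] -/
theorem relaxedDirichletEnergy_sub_sdiff (V : ℝ → ℝ) (A : Finset (ℤ × ℤ)) {A' A'' : Finset (ℤ × ℤ)}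
    (hA'' : A'' ⊆ A') (y : ℤ × ℤ → Plane) :
    relaxedDirichletEnergy V A A' y - relaxedDirichletEnergy V A (A' \ A'') y =
      ∑ k ∈ A'', (∑ k' ∈ A' \ A'', V (dist (y k) (y k')) +
        (∑ k' ∈ A''.erase k, V (dist (y k) (y k'))) / 2 +
          ∑' k' : {k' : ℤ × ℤ // k' ∉ A}, V (dist (y k) (y k'.1))) := by
  classical
  have hdisj : Disjoint (A' \ A'') A'' := Finset.sdiff_disjoint
  have hunion : A' \ A'' ∪ A'' = A' := Finset.sdiff_union_of_subset hA''
  have hpair := sum_sum_erase_union hdisj (fun k k' => V (dist (y k) (y k')))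
    (fun a b => by rw [dist_comm])
  rw [hunion] at hpair
  have hrows : ∑ k ∈ A', ∑' k' : {k' : ℤ × ℤ // k' ∉ A}, V (dist (y k) (y k'.1)) =
      ∑ k ∈ A' \ A'', ∑' k' : {k' : ℤ × ℤ // k' ∉ A}, V (dist (y k) (y k'.1)) +
        ∑ k ∈ A'', ∑' k' : {k' : ℤ × ℤ // k' ∉ A}, V (dist (y k) (y k'.1)) :=
    (Finset.sum_sdiff hA'').symm
  rw [relaxedDirichletEnergy, relaxedDirichletEnergy, hpair, hrows, Finset.sum_add_distrib,
    Finset.sum_add_distrib, ← Finset.sum_div]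
  ring

end Difference

/-! ### Rows of a clamped configuration: local finiteness and summability -/

section Rows

variable {α : ℝ} {V : ℝ → ℝ} {A : Finset (ℤ × ℤ)} {y : ℤ × ℤ → Plane}

/-- The configuration `(A₂ ∖ 𝒜) ∪ 𝒜` of a clamped `y ∈ Y_𝒜^Dir` is locally finite: only finitely
many labels have their particle in a given disc. [cite: Theil2006, §1 Corollary 1.3 (`Y_𝒜^Dir`, preprint p. 3); our lemma] -/
theorem IsClampedOutside.finite_dist_le (hy : IsClampedOutside A y) (η : Plane) (R : ℝ) :
    {k : ℤ × ℤ | dist (y k) η ≤ R}.Finite := by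
  have h := Filter.eventually_cofinite.1
    ((tendsto_norm_sub_triPoint_cofinite η).eventually_gt_atTop R)
  refine (A.finite_toSet.union h).subset fun k hk => ?_
  rw [Set.mem_setOf_eq] at hk
  by_cases hkA : k ∈ A
  · exact Or.inl hkA
  · refine Or.inr ?_
    rw [Set.mem_setOf_eq, not_lt, norm_sub_rev, ← dist_eq_norm, ← hy k hkA]
    exact hk

/-- **Rows converge.** For admissible `V` and `y ∈ Y_𝒜^Dir`, `x' ↦ V(|p − y(x')|)` is summable
over all labels (the clamped lattice by decay (12), `IsAdmissible.summable_norm_sub`; finitely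
many free particles). [cite: Theil2006, §1 Corollary 1.3 (`E_𝒜`, preprint p. 3); our lemma] -/
theorem IsClampedOutside.summable_row (hV : IsAdmissible α V) (hy : IsClampedOutside A y)
    (p : Plane) : Summable fun k : ℤ × ℤ => V (dist p (y k)) := by
  refine (A.summable_compl_iff (f := fun k : ℤ × ℤ => V (dist p (y k)))).1 ?_
  refine ((hV.summable_norm_sub p).subtype {k | k ∉ A}).congr fun k => ?_
  change V ‖p - triPoint k.1‖ = V (dist p (y k.1))
  rw [dist_eq_norm, hy k.1 k.2]

end Rows

/-! ### Lemma 2.2 in the relaxed Dirichlet class: crowded discs are removed with profit -/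

section Removal

variable {α : ℝ} {V : ℝ → ℝ} {A A' : Finset (ℤ × ℤ)} {y : ℤ × ℤ → Plane}

/-- **The mechanism of Lemma 2.2 for the relaxed Dirichlet energy** ("the proof of Lemma 2.2
can be repeated for this case, word by word", p. 14), for an ARBITRARY competitor: let
`0 < α < 1/13447168`, `V` satisfy (1)–(5), `𝒜'` finite (in the application `𝒜' ⊆ 𝒜`) and
`y ∈ Y_𝒜^Dir`. If two particles of
`X = (A₂ ∖ 𝒜) ∪ 𝒜'` are at distance `≤ 1 − α`, then for the free particles `𝒜'' ≠ ∅` of a most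
crowded disc `B(η₀, ½(1 − α))` (`M ≥ 2` particles; "Define
`M := max_η #(y(X) ∩ B(η, ½(1 − α)))` … `𝒜 = y⁻¹(B_M)`", p. 6) removal strictly lowers the
energy, `E(𝒜' ∖ 𝒜'', {y}) < E(𝒜', {y})`: each removed particle releases `≥ (M−1)/(2α)` through
its `M − 1` companions in the disc ((2): `V ≥ 1/α` on `[0, 1−α]`; at most one companion is
clamped, since points of `A₂` are `≥ 1` apart) and loses `≤ 2WM`, `W = 4 · 420224`, through all
other bonds ((11) near, (12) far, at most `M` particles per grid cell of side `½(1 − α)`: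
`IsAdmissible.neg_cellWeight_le`, `sum_cellWeight_le_finset`), and `(M−1)/(2α) > 2WM` for
`M ≥ 2`, `α < 1/(8W)`. [cite: Theil2006, §2.2 proof of Lemma 2.2 (14)–(17) (preprint p. 6); §3 Proof of Corollary 1.3 (p. 14)] -/
theorem exists_relaxedDirichletEnergy_lt (hα : 0 < α) (hαlt : α < 1 / 13447168)
    (hV : IsAdmissible α V) (hy : IsClampedOutside A y)
    {x₁ x₂ : ℤ × ℤ} (hx₁ : x₁ ∉ A ∨ x₁ ∈ A') (hx₂ : x₂ ∉ A ∨ x₂ ∈ A') (hne : x₁ ≠ x₂)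
    (hclose : dist (y x₁) (y x₂) ≤ 1 - α) :
    ∃ A'' : Finset (ℤ × ℤ), A'' ⊆ A' ∧ A''.Nonempty ∧
      relaxedDirichletEnergy V A (A' \ A'') y < relaxedDirichletEnergy V A A' y := by
  classical
  have hα5 : α ≤ 1 / 5 := by linarith
  set ρ := (1 - α) / 2 with hρdef
  have hρ25 : 2 / 5 ≤ ρ := by rw [hρdef]; linarith
  have hρ0 : 0 < ρ := by linarith
  -- the particles `X = (A₂ ∖ 𝒜) ∪ 𝒜'`
  set X : Set (ℤ × ℤ) := {k | k ∉ A ∨ k ∈ A'} with hXdef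
  have hXA : ∀ k ∈ X, k ∈ A → k ∈ A' := fun k hk hkA => hk.resolve_left fun h => h hkA
  -- summable rows
  have hsumm : ∀ p : Plane, Summable fun k : ℤ × ℤ => V (dist p (y k)) :=
    fun p => hy.summable_row hV p
  -- the particles of `X` in a closed disc of radius `ρ`: finite sets
  have hfin : ∀ η : Plane, ({k : ℤ × ℤ | k ∈ X ∧ dist (y k) η ≤ ρ}).Finite := fun η =>
    (hy.finite_dist_le η ρ).subset fun k hk => hk.2
  have hmemD : ∀ η k, k ∈ (hfin η).toFinset ↔ k ∈ X ∧ dist (y k) η ≤ ρ := fun η k =>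
    Set.Finite.mem_toFinset _
  set cnt : Plane → ℕ := fun η => (hfin η).toFinset.card with hcnt
  -- two particles of one disc are at distance `≤ 1 - α`
  have hdisc : ∀ (η : Plane) (k k' : ℤ × ℤ), dist (y k) η ≤ ρ → dist (y k') η ≤ ρ →
      dist (y k) (y k') ≤ 1 - α := by
    intro η k k' hk hk'
    have := dist_triangle (y k) η (y k')
    rw [dist_comm η] at this
    rw [hρdef] at hk hk'
    linarith
  -- two clamped particles are `≥ 1` apart, hence never in one disc
  have hlat : ∀ k k' : ℤ × ℤ, k ∉ A → k' ∉ A → k ≠ k' → 1 - α < dist (y k) (y k') := by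
    intro k k' hk hk' hkk'
    rw [hy k hk, hy k' hk', dist_triPoint]
    have := one_le_norm_triPoint (sub_ne_zero.2 hkk')
    linarith
  have hclamped : ∀ (η : Plane) (k k' : ℤ × ℤ), k ∉ A → k' ∉ A → dist (y k) η ≤ ρ →
      dist (y k') η ≤ ρ → k = k' := by
    intro η k k' hk hk' hd hd'
    by_contra hkk'
    have h1 := hlat k k' hk hk' hkk'
    have h2 := hdisc η k k' hd hd'
    linarith
  -- at most `#𝒜' + 1` particles in a disc
  have hbdd : ∀ η, cnt η ≤ A'.card + 1 := by
    intro η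
    have hsplit := Finset.card_filter_add_card_filter_not (s := (hfin η).toFinset)
      (fun k => k ∈ A)
    have h1 : ((hfin η).toFinset.filter fun k => k ∈ A).card ≤ A'.card := by
      refine Finset.card_le_card fun k hk => ?_
      rw [Finset.mem_filter, hmemD] at hk
      exact hXA k hk.1.1 hk.2
    have h2 : ((hfin η).toFinset.filter fun k => ¬ k ∈ A).card ≤ 1 := by
      refine Finset.card_le_one.2 fun k hk k' hk' => ?_
      rw [Finset.mem_filter, hmemD] at hk hk'
      exact hclamped η k k' hk.2 hk'.2 hk.1.2 hk'.1.2
    change (hfin η).toFinset.card ≤ A'.card + 1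
    omega
  -- the maximal count `M`, attained at `η₀`
  have hBdd : BddAbove (Set.range cnt) := ⟨A'.card + 1, by rintro _ ⟨η, rfl⟩; exact hbdd η⟩
  set M := sSup (Set.range cnt) with hMdef
  have hle : ∀ η, cnt η ≤ M := fun η => le_csSup hBdd ⟨η, rfl⟩
  obtain ⟨η₀, hη₀⟩ : ∃ η₀, cnt η₀ = M := Nat.sSup_mem (s := Set.range cnt) ⟨cnt 0, 0, rfl⟩ hBdd
  -- the close pair forces `M ≥ 2`
  have hM2 : 2 ≤ M := by
    set m : Plane := (2 : ℝ)⁻¹ • (y x₁ + y x₂) with hm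
    have hd1 : dist (y x₁) m ≤ ρ := by
      have e : y x₁ - m = (2 : ℝ)⁻¹ • (y x₁ - y x₂) := by rw [hm]; module
      rw [dist_eq_norm, e, norm_smul, Real.norm_eq_abs, abs_of_pos (by norm_num), ← dist_eq_norm]
      rw [hρdef]; linarith
    have hd2 : dist (y x₂) m ≤ ρ := by
      have e : y x₂ - m = (2 : ℝ)⁻¹ • (y x₂ - y x₁) := by rw [hm]; module
      rw [dist_eq_norm, e, norm_smul, Real.norm_eq_abs, abs_of_pos (by norm_num), ← dist_eq_norm,
        dist_comm]
      rw [hρdef]; linarith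
    have hsub : ({x₁, x₂} : Finset (ℤ × ℤ)) ⊆ (hfin m).toFinset := by
      intro k hk
      rw [Finset.mem_insert, Finset.mem_singleton] at hk
      rw [hmemD]
      rcases hk with rfl | rfl
      · exact ⟨hx₁, hd1⟩
      · exact ⟨hx₂, hd2⟩
    have := Finset.card_le_card hsub
    rw [Finset.card_pair hne] at this
    exact this.trans (hle m)
  -- the crowded disc `𝒜₀`, its free particles `𝒜''` and its clamped particles `C₀`
  set A0 : Finset (ℤ × ℤ) := (hfin η₀).toFinset with hA0
  have hA0mem : ∀ k, k ∈ A0 ↔ k ∈ X ∧ dist (y k) η₀ ≤ ρ := hmemD η₀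
  have hA0card : A0.card = M := hη₀
  set A'' : Finset (ℤ × ℤ) := A0.filter fun k => k ∈ A with hA''def
  set C0 : Finset (ℤ × ℤ) := A0.filter fun k => ¬ k ∈ A with hC0def
  have hA''mem : ∀ k, k ∈ A'' ↔ (k ∈ X ∧ dist (y k) η₀ ≤ ρ) ∧ k ∈ A := fun k => by
    rw [hA''def, Finset.mem_filter, hA0mem]
  have hC0mem : ∀ k, k ∈ C0 ↔ (k ∈ X ∧ dist (y k) η₀ ≤ ρ) ∧ k ∉ A := fun k => by
    rw [hC0def, Finset.mem_filter, hA0mem]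
  have hA''sub : A'' ⊆ A' := fun k hk => by
    have h := (hA''mem k).1 hk
    exact hXA k h.1.1 h.2
  have hcardsum : A''.card + C0.card = M := by
    rw [hA''def, hC0def, Finset.card_filter_add_card_filter_not, hA0card]
  have hC0card : C0.card ≤ 1 := by
    refine Finset.card_le_one.2 fun k hk k' hk' => ?_
    rw [hC0mem] at hk hk'
    exact hclamped η₀ k k' hk.2 hk'.2 hk.1.2 hk'.1.2
  have hA''pos : 1 ≤ A''.card := by omega
  have hA''ne : A''.Nonempty := Finset.card_pos.1 (by omega)
  refine ⟨A'', hA''sub, hA''ne, ?_⟩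
  set B : Finset (ℤ × ℤ) := A' \ A'' with hBdef
  have hBX : ∀ k ∈ B, k ∈ X := fun k hk => Or.inr (Finset.mem_sdiff.1 hk).1
  -- the cell weights and the uniform row bound `≥ -W M`
  set wt : ℤ → ℝ := fun n => ((((n.natAbs : ℕ) : ℝ) + 1) * (((n.natAbs : ℕ) : ℝ) + 2))⁻¹ with hwt
  have hrow : ∀ (x : ℤ × ℤ) (η : Plane), dist (y x) η ≤ ρ → ∀ T : Set (ℤ × ℤ), T ⊆ X →
      -(4 * 420224 * (M : ℝ)) ≤ ∑' k' : T, V (dist (y x) (y k')) := by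
    intro x η hxη T hTX
    have hs : Summable fun k' : T => V (dist (y x) (y k')) := (hsumm (y x)).subtype _
    have hneg : ∑' k' : T, -V (dist (y x) (y k')) ≤ 4 * 420224 * (M : ℝ) := by
      refine hs.neg.tsum_le_of_sum_le fun u => ?_
      have hterm : ∀ k' ∈ u, -V (dist (y x) (y (k' : ℤ × ℤ))) ≤
          420224 * (wt ⌊(y k' 0 - η 0) / ρ⌋ * wt ⌊(y k' 1 - η 1) / ρ⌋) := by
        intro k' _
        have := hV.neg_cellWeight_le hα hα5 hρ25 η (y x) (y k') hxη
        simp only [hwt]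
        linarith
      refine (Finset.sum_le_sum hterm).trans ?_
      rw [← Finset.mul_sum]
      have hMu : ∀ z : Plane, (u.filter fun k' : T => dist (y k') z ≤ ρ).card ≤ M := by
        intro z
        refine le_trans ?_ (hle z)
        refine Finset.card_le_card_of_injOn (fun k' : T => (k' : ℤ × ℤ)) ?_
          (Subtype.val_injective.injOn)
        intro k' hk'
        rw [Finset.mem_coe, Finset.mem_filter] at hk'
        rw [Finset.mem_coe, hmemD]
        exact ⟨hTX k'.2, hk'.2⟩
      have h := sum_cellWeight_le_finset u (fun k' : T => y k') η hρ0 (M := M) hMu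
        (f := fun c : ℤ × ℤ => wt c.1 * wt c.2) (fun c => by positivity) (F := 4)
        (fun t => by simpa [hwt] using sum_prod_inv_natAbs_le_four t)
      nlinarith
    rw [tsum_neg] at hneg
    linarith
  have hrowfin : ∀ (x : ℤ × ℤ) (η : Plane), dist (y x) η ≤ ρ → ∀ u : Finset (ℤ × ℤ),
      (∀ k ∈ u, k ∈ X) → -(4 * 420224 * (M : ℝ)) ≤ ∑ k' ∈ u, V (dist (y x) (y k')) := by
    intro x η hxη u huX
    have h := hrow x η hxη (↑u) fun k hk => huX k hk
    rwa [Finset.tsum_subtype' u (fun k' => V (dist (y x) (y k')))] at h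
  -- per removed particle: released `≥ (M-1)/(2α)`, lost `≤ 2 W M`
  have hkey : ∀ k ∈ A'', ((M : ℝ) - 1) * (1 / α) / 2 - 2 * (4 * 420224 * (M : ℝ)) ≤
      ∑ k' ∈ B, V (dist (y k) (y k')) + (∑ k' ∈ A''.erase k, V (dist (y k) (y k'))) / 2 +
        ∑' k' : {k' : ℤ × ℤ // k' ∉ A}, V (dist (y k) (y k'.1)) := by
    intro k hk
    have hkd : dist (y k) η₀ ≤ ρ := ((hA''mem k).1 hk).1.2
    -- (i) the remaining free particles
    have h1 : -(4 * 420224 * (M : ℝ)) ≤ ∑ k' ∈ B, V (dist (y k) (y k')) :=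
      hrowfin k η₀ hkd B hBX
    -- (ii) the free companions in the disc, `≥ 1/α` each by (2)
    have h2 : ((A''.card : ℝ) - 1) * (1 / α) ≤ ∑ k' ∈ A''.erase k, V (dist (y k) (y k')) := by
      have hcard : ((A''.erase k).card : ℝ) = A''.card - 1 := by
        rw [Finset.card_erase_of_mem hk, Nat.cast_sub (by omega), Nat.cast_one]
      have h := Finset.card_nsmul_le_sum (A''.erase k) (fun k' => V (dist (y k) (y k'))) (1 / α)
        fun k' hk' => by
          have hk'A := Finset.mem_of_mem_erase hk'
          exact hV.core _ ⟨dist_nonneg, hdisc η₀ _ _ hkd ((hA''mem k').1 hk'A).1.2⟩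
      rw [nsmul_eq_mul, hcard] at h
      exact h
    -- (iii) the clamped particles: the (at most one) clamped companion `≥ 1/α`, the rest `≥ -WM`
    have h3 : (C0.card : ℝ) * (1 / α) - 4 * 420224 * (M : ℝ) ≤
        ∑' k' : {k' : ℤ × ℤ // k' ∉ A}, V (dist (y k) (y k'.1)) := by
      have e1 : ({k' : ℤ × ℤ | k' ∉ A} : Set (ℤ × ℤ)) = ↑C0 ∪ {k' | k' ∉ A ∧ k' ∉ C0} := by
        ext k'
        simp only [Set.mem_setOf_eq, Set.mem_union, Finset.mem_coe]
        constructor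
        · intro hk'A
          by_cases hk'C : k' ∈ C0
          · exact Or.inl hk'C
          · exact Or.inr ⟨hk'A, hk'C⟩
        · rintro (hk'C | ⟨hk'A, -⟩)
          · exact ((hC0mem k').1 hk'C).2
          · exact hk'A
      have hdisj : Disjoint (↑C0 : Set (ℤ × ℤ)) {k' | k' ∉ A ∧ k' ∉ C0} :=
        Set.disjoint_left.2 fun k' hk' hk'' => hk''.2 hk'
      have step : (∑' k' : ({k' : ℤ × ℤ | k' ∉ A} : Set (ℤ × ℤ)), V (dist (y k) (y k'))) =
          (∑ k' ∈ C0, V (dist (y k) (y k'))) +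
            ∑' k' : ({k' : ℤ × ℤ | k' ∉ A ∧ k' ∉ C0} : Set (ℤ × ℤ)), V (dist (y k) (y k')) := by
        rw [tsum_congr_set_coe (fun k' => V (dist (y k) (y k'))) e1,
          Summable.tsum_union_disjoint hdisj ((hsumm _).subtype _) ((hsumm _).subtype _),
          Finset.tsum_subtype' C0 (fun k' => V (dist (y k) (y k')))]
      have hC0sum : (C0.card : ℝ) * (1 / α) ≤ ∑ k' ∈ C0, V (dist (y k) (y k')) := by
        have h := Finset.card_nsmul_le_sum C0 (fun k' => V (dist (y k) (y k'))) (1 / α)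
          fun k' hk' => hV.core _ ⟨dist_nonneg, hdisc η₀ _ _ hkd ((hC0mem k').1 hk').1.2⟩
        rw [nsmul_eq_mul] at h
        exact h
      have hrest := hrow k η₀ hkd {k' | k' ∉ A ∧ k' ∉ C0} fun k' hk' => Or.inl hk'.1
      change (C0.card : ℝ) * (1 / α) - 4 * 420224 * (M : ℝ) ≤
        ∑' k' : ({k' : ℤ × ℤ | k' ∉ A} : Set (ℤ × ℤ)), V (dist (y k) (y k'))
      rw [step]
      linarith
    -- combine: `(#𝒜'' - 1)/2 + #C₀ ≥ (M - 1)/2` since `#𝒜'' + #C₀ = M`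
    have hM' : (A''.card : ℝ) + C0.card = M := by rw [← hcardsum, Nat.cast_add]
    have ht : 0 ≤ (C0.card : ℝ) * (1 / α) :=
      mul_nonneg (Nat.cast_nonneg _) (one_div_pos.2 hα).le
    have hMt : ((M : ℝ) - 1) * (1 / α) = ((A''.card : ℝ) - 1) * (1 / α) + (C0.card : ℝ) * (1 / α) := by
      rw [← hM']; ring
    linarith
  -- summing over the removed particles
  have htotal : (A''.card : ℝ) * (((M : ℝ) - 1) * (1 / α) / 2 - 2 * (4 * 420224 * (M : ℝ))) ≤
      relaxedDirichletEnergy V A A' y - relaxedDirichletEnergy V A B y := by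
    rw [hBdef, relaxedDirichletEnergy_sub_sdiff V A hA''sub y]
    have h := Finset.sum_le_sum hkey
    rw [Finset.sum_const, nsmul_eq_mul] at h
    exact h
  -- the released energy is positive for `M ≥ 2` and `α < 1/(8W)`
  have hM2r : (2 : ℝ) ≤ M := by exact_mod_cast hM2
  have hMα : (M : ℝ) * α < (M : ℝ) * (1 / 13447168) :=
    mul_lt_mul_of_pos_left hαlt (by linarith)
  have hpos : 0 < ((M : ℝ) - 1) * (1 / α) / 2 - 2 * (4 * 420224 * (M : ℝ)) := by
    have hnum : 0 < ((M : ℝ) - 1) / 2 - 2 * (4 * 420224 * (M : ℝ)) * α := by nlinarith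
    have e : ((M : ℝ) - 1) * (1 / α) / 2 - 2 * (4 * 420224 * (M : ℝ)) =
        (((M : ℝ) - 1) / 2 - 2 * (4 * 420224 * (M : ℝ)) * α) / α := by
      field_simp
    rw [e]
    exact div_pos hnum hα
  have hA''r : (1 : ℝ) ≤ A''.card := by
    have h := Nat.cast_le (α := ℝ) |>.2 hA''pos
    rwa [Nat.cast_one] at h
  have hprod : 0 < (A''.card : ℝ) * (((M : ℝ) - 1) * (1 / α) / 2 - 2 * (4 * 420224 * (M : ℝ))) :=
    mul_pos (by linarith) hpos
  linarith

/-- **(13) for the minimizers of the relaxed Dirichlet problem** — "Clearly `y_min` satisfies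
the bound (13) since the proof of Lemma 2.2 can be repeated for this case, word by word"
(p. 14), with the explicit threshold `α₀ = 1/13447168` of the tree's Lemma 2.2: any two
particles of `X = (A₂ ∖ 𝒜) ∪ 𝒜_min` are at distance `> 1 − α` (otherwise
`exists_relaxedDirichletEnergy_lt` produces a cheaper competitor).
[cite: Theil2006, §3 Proof of Corollary 1.3 (preprint p. 14), with §2.2 Lemma 2.2 (13) (p. 6)] -/
theorem IsRelaxedDirichletMinimizer.lt_dist (hα : 0 < α) (hαlt : α < 1 / 13447168)
    (hV : IsAdmissible α V) (hmin : IsRelaxedDirichletMinimizer V A A' y)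
    {x₁ x₂ : ℤ × ℤ} (hx₁ : x₁ ∉ A ∨ x₁ ∈ A') (hx₂ : x₂ ∉ A ∨ x₂ ∈ A') (hne : x₁ ≠ x₂) :
    1 - α < dist (y x₁) (y x₂) := by
  by_contra hcon
  rw [not_lt] at hcon
  obtain ⟨A'', hA''sub, -, hlt⟩ :=
    exists_relaxedDirichletEnergy_lt hα hαlt hV hmin.2.1 hx₁ hx₂ hne hcon
  have hle := hmin.2.2 (A' \ A'') y (Finset.sdiff_subset.trans hmin.1) hmin.2.1
  linarith

end Removal

/-- **Theil 2006, Proof of Corollary 1.3, first step (preprint p. 14): the minimum distance (13)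
in the relaxed Dirichlet class.** "Let `𝒜_min, y_min` be the minimizer of `E(·, ·)`. Clearly
`y_min` satisfies the bound (13) since the proof of Lemma 2.2 can be repeated for this case, word
by word" [(13): `min_{x ≠ x'} |y(x) − y(x')| > 1 − α`]. Here `E(𝒜', {y})` is
`relaxedDirichletEnergy V 𝒜 𝒜' y` over `𝒜' ⊆ 𝒜` and `y ∈ Y_𝒜^Dir`, the particles are those
of `X = (A₂ ∖ 𝒜) ∪ 𝒜'`, `V` satisfies (1)–(5) (`IsAdmissible α V`, real-valued), and there is a
universal `α₀ ∈ (0, ½)` (`= 1/13447168`, as for Lemmas 2.2 and 3.1 in the tree). PROVED.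
[cite: Theil2006, §3 Proof of Corollary 1.3 (preprint p. 14)] -/
theorem dirichletMinimumDistance :
    ∃ α₀ : ℝ, 0 < α₀ ∧ α₀ < 1 / 2 ∧ ∀ α : ℝ, 0 < α → α < α₀ →
      ∀ V : ℝ → ℝ, IsAdmissible α V → ∀ (A A' : Finset (ℤ × ℤ)) (y : ℤ × ℤ → Plane),
        IsRelaxedDirichletMinimizer V A A' y →
          ∀ x, (x ∉ A ∨ x ∈ A') → ∀ x', (x' ∉ A ∨ x' ∈ A') → x ≠ x' →
            1 - α < dist (y x) (y x') :=
  ⟨1 / 13447168, by norm_num, by norm_num, fun _α hα hαlt _V hV _A _A' _y hmin _x hx _x' hx'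
    hne => hmin.lt_dist hα hαlt hV hx hx' hne⟩

/-! ### Existence of a minimizer of the relaxed Dirichlet problem, for continuous `V` -/

section Existence

variable {α : ℝ} {V : ℝ → ℝ} {A A' : Finset (ℤ × ℤ)} {y : ℤ × ℤ → Plane}

/-- Every point of the plane is within `9/10` of a point of `A₂` (round the `b₂`-coordinate, then
the `b₁`-coordinate: the error is `≤ √7/4`; the covering radius of `A₂` is `1/√3`, and any
constant `< 1 − α` suffices below). [folklore] -/
private theorem exists_dist_triPoint_le (p : Plane) : ∃ a : ℤ × ℤ, dist p (triPoint a) ≤ 9 / 10 := by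
  have h3 : (0 : ℝ) < √3 := Real.sqrt_pos.2 (by norm_num)
  have hs3 : (√3 : ℝ) ^ 2 = 3 := Real.sq_sqrt (by norm_num)
  set t : ℝ := 2 * p 1 / √3 with ht
  set n : ℤ := round t with hn
  set m : ℤ := round (p 0 - (n : ℝ) / 2) with hm
  refine ⟨(m, n), ?_⟩
  have hδ₂ := abs_le.1 (abs_sub_round t)
  have hδ₁ := abs_le.1 (abs_sub_round (p 0 - (n : ℝ) / 2))
  rw [← hn] at hδ₂
  rw [← hm] at hδ₁
  have e1 : p 1 = √3 / 2 * t := by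
    rw [ht]; field_simp
  have hsq : dist p (triPoint (m, n)) ^ 2 =
      (p 0 - (n : ℝ) / 2 - m) ^ 2 + 3 / 4 * (t - n) ^ 2 := by
    rw [EuclideanSpace.dist_eq, Real.sq_sqrt (Finset.sum_nonneg fun i _ => sq_nonneg _),
      Fin.sum_univ_two, Real.dist_eq, Real.dist_eq, sq_abs, sq_abs, triPoint_apply_zero,
      triPoint_apply_one, e1]
    dsimp only
    linear_combination ((t - (n : ℝ)) ^ 2 / 4) * hs3
  have hsq' : dist p (triPoint (m, n)) ^ 2 ≤ 7 / 16 := by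
    rw [hsq]
    nlinarith [hδ₁.1, hδ₁.2, hδ₂.1, hδ₂.2]
  nlinarith [dist_nonneg (x := p) (y := triPoint (m, n)), hsq']

/-- **Free particles of a relaxed minimizer stay within distance `1` of `𝒜`** (for
`0 < α < 1/13447168` and admissible `V`): a free particle farther away would be within
`9/10 ≤ 1 − α` of a clamped lattice site, against (13). (Used for the periodization step of the
proof of Corollary 1.3, p. 14: "Due to the compactness of `𝒜` we can assume that `A ⊂ B(0, C)`".)
[cite: Theil2006, §3 Proof of Corollary 1.3 (preprint p. 14); our lemma] -/
theorem IsRelaxedDirichletMinimizer.exists_dist_triPoint_le_one (hα : 0 < α)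
    (hαlt : α < 1 / 13447168) (hV : IsAdmissible α V) (hmin : IsRelaxedDirichletMinimizer V A A' y)
    {x : ℤ × ℤ} (hx : x ∈ A') : ∃ a ∈ A, dist (y x) (triPoint a) ≤ 1 := by
  by_contra hfar
  push Not at hfar
  obtain ⟨a₀, ha₀⟩ := exists_dist_triPoint_le (y x)
  have ha₀A : a₀ ∉ A := fun h => by linarith [hfar a₀ h]
  have hne : x ≠ a₀ := fun h => ha₀A (h ▸ hmin.1 hx)
  have h13 := hmin.lt_dist hα hαlt hV (Or.inr hx) (Or.inl ha₀A) hne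
  rw [hmin.2.1 a₀ ha₀A] at h13
  linarith

/-- **Free data on `𝒜`, clamped outside**: the configuration `y ∈ Y_𝒜^Dir` with `y(x) = u(x)` for
`x ∈ 𝒜` and `y(x) = x` for `x ∈ A₂ ∖ 𝒜`. [cite: Theil2006, §1 Corollary 1.3 (`Y_𝒜^Dir`, preprint p. 3)] -/
def clampedExtend (A : Finset (ℤ × ℤ)) (u : A → Plane) (k : ℤ × ℤ) : Plane :=
  if h : k ∈ A then u ⟨k, h⟩ else triPoint k

/-- On `𝒜` the extension is the free data. [folklore] -/
private theorem clampedExtend_of_mem (u : A → Plane) {k : ℤ × ℤ} (hk : k ∈ A) :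
    clampedExtend A u k = u ⟨k, hk⟩ := by
  simp [clampedExtend, hk]

/-- Off `𝒜` the extension is the lattice. [folklore] -/
private theorem clampedExtend_of_not_mem (u : A → Plane) {k : ℤ × ℤ} (hk : k ∉ A) :
    clampedExtend A u k = triPoint k := by
  simp [clampedExtend, hk]

/-- `clampedExtend A u ∈ Y_𝒜^Dir`. [cite: Theil2006, §1 Corollary 1.3 (`Y_𝒜^Dir`, preprint p. 3)] -/
theorem isClampedOutside_clampedExtend (u : A → Plane) : IsClampedOutside A (clampedExtend A u) :=
  fun _ hk => clampedExtend_of_not_mem u hk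

/-- Each particle position depends continuously on the free data. [folklore] -/
private theorem continuous_clampedExtend_apply (A : Finset (ℤ × ℤ)) (k : ℤ × ℤ) :
    Continuous fun u : A → Plane => clampedExtend A u k := by
  by_cases hk : k ∈ A
  · simp only [clampedExtend, dif_pos hk]
    exact continuous_apply _
  · simp only [clampedExtend, dif_neg hk]
    exact continuous_const

/-- `E(𝒜', {y})` only depends on the positions of the retained free particles `𝒜'` and of the
clamped ones. [cite: Theil2006, §3 Proof of Corollary 1.3 (preprint p. 14)] -/
theorem relaxedDirichletEnergy_congr {y' : ℤ × ℤ → Plane} (hA' : ∀ k ∈ A', y k = y' k)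
    (hout : ∀ k ∉ A, y k = y' k) :
    relaxedDirichletEnergy V A A' y = relaxedDirichletEnergy V A A' y' := by
  unfold relaxedDirichletEnergy
  congr 1
  · congr 1
    refine Finset.sum_congr rfl fun k hk => Finset.sum_congr rfl fun k' hk' => ?_
    rw [hA' k hk, hA' k' (Finset.mem_of_mem_erase hk')]
  · refine Finset.sum_congr rfl fun k hk => tsum_congr fun k' => ?_
    rw [hA' k hk, hout k'.1 k'.2]

/-- **The clamped rows are continuous**: for `V` satisfying (1)–(5) and continuous on `[0, ∞)`,
`p ↦ ∑_{x' ∈ A₂ ∖ 𝒜} V(|p − x'|)` is continuous on `ℝ²` (on each ball a uniformly dominated series: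
near terms by `max |V|` on a compact interval, far terms by the decay (12) against the lattice
`p`-series). [cite: Theil2006, §3 Proof of Corollary 1.3 («Let 𝒜_min, y_min be the minimizer of E(·,·)», preprint p. 14); our lemma] -/
theorem continuous_clampedRow (hV : IsAdmissible α V) (hVc : ContinuousOn V (Ici 0))
    (A : Finset (ℤ × ℤ)) :
    Continuous fun p : Plane => ∑' k' : {k' : ℤ × ℤ // k' ∉ A}, V (dist p (triPoint k'.1)) := by
  have hα := hV.alpha_nonneg
  rw [continuous_iff_continuousAt]
  intro p₀
  obtain ⟨n, hn⟩ := exists_nat_gt ‖p₀‖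
  suffices h : ContinuousOn
      (fun p : Plane => ∑' k' : {k' : ℤ × ℤ // k' ∉ A}, V (dist p (triPoint k'.1)))
      (Metric.closedBall 0 n) from
    (h.mono Metric.ball_subset_closedBall).continuousAt
      (Metric.isOpen_ball.mem_nhds (by simpa using hn))
  -- constants of the domination
  set T : ℝ := 2 * n + 4 / 3 with hT
  set Rad : ℝ := n + T with hRad
  obtain ⟨M, hM⟩ := (isCompact_Icc : IsCompact (Icc (0 : ℝ) Rad)).exists_bound_of_continuousOn
    (hVc.mono Icc_subset_Ici_self)
  set b : ℤ × ℤ → ℝ := fun g =>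
    if ‖triPoint g‖ ≤ T then max M 0 else α * (‖triPoint g‖ - n)⁻¹ ^ 5 with hb
  have hb_nonneg : ∀ g, 0 ≤ b g := fun g => by
    simp only [hb]
    split_ifs with h
    · exact le_max_right _ _
    · have : 0 ≤ ‖triPoint g‖ - n := by rw [not_le, hT] at h; linarith
      positivity
  -- summability of `b` over `A₂`
  have hb_summ : Summable b := by
    refine Summable.of_norm_bounded_eventually
      ((summable_norm_triPoint_inv_pow).mul_left (32 * α)) ?_
    filter_upwards [tendsto_norm_triPoint_cofinite.eventually_ge_atTop (max T (2 * n) + 1)]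
      with g hg
    have hgT : ¬ ‖triPoint g‖ ≤ T := by
      have := le_max_left T (2 * n); rw [not_le]; linarith
    have hg2 : 2 * (n : ℝ) ≤ ‖triPoint g‖ := by linarith [le_max_right T (2 * n)]
    rw [Real.norm_eq_abs, abs_of_nonneg (hb_nonneg g)]
    simp only [hb, if_neg hgT]
    have hpos : 0 < ‖triPoint g‖ := by linarith [le_max_left T (2 * n)]
    have hden : ‖triPoint g‖ / 2 ≤ ‖triPoint g‖ - n := by linarith
    have h1 : (‖triPoint g‖ - n)⁻¹ ≤ (‖triPoint g‖ / 2)⁻¹ := inv_anti₀ (by positivity) hden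
    have h2 : (‖triPoint g‖ - n)⁻¹ ^ 5 ≤ (‖triPoint g‖ / 2)⁻¹ ^ 5 :=
      pow_le_pow_left₀ (le_of_lt (inv_pos.2 (by linarith))) h1 5
    have h3 : (‖triPoint g‖ / 2)⁻¹ ^ 5 = 32 * ‖triPoint g‖⁻¹ ^ 5 := by
      rw [inv_div, div_pow, inv_pow]; ring
    calc α * (‖triPoint g‖ - n)⁻¹ ^ 5 ≤ α * (32 * ‖triPoint g‖⁻¹ ^ 5) := by
          rw [← h3]; exact mul_le_mul_of_nonneg_left h2 hα
      _ = 32 * α * ‖triPoint g‖⁻¹ ^ 5 := by ring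
  -- the dominated-continuity criterion
  refine continuousOn_tsum (u := fun k' : {k' : ℤ × ℤ // k' ∉ A} => b k'.1) (fun k' => ?_)
    (hb_summ.subtype _) (fun k' p hp => ?_)
  · exact (hVc.comp_continuous (continuous_id.dist continuous_const)
      fun p => dist_nonneg).continuousOn
  · have hpn : ‖p‖ ≤ n := by simpa using hp
    set d : ℝ := dist p (triPoint k'.1) with hd
    have hd_le : d ≤ n + ‖triPoint k'.1‖ := by
      rw [hd, dist_eq_norm]
      linarith [norm_sub_le p (triPoint k'.1)]
    have hd_ge : ‖triPoint k'.1‖ - n ≤ d := by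
      rw [hd, dist_eq_norm, ← norm_sub_rev]
      linarith [norm_sub_norm_le (triPoint k'.1) p]
    have hd0 : 0 ≤ d := dist_nonneg
    rw [Real.norm_eq_abs]
    simp only [hb]
    split_ifs with hcase
    · -- near: `d ≤ Rad`, `|V d| ≤ M`
      have hdR : d ∈ Icc (0 : ℝ) Rad := ⟨hd0, by rw [hRad]; linarith⟩
      exact (hM d hdR).trans (le_max_left _ _)
    · -- far: `d ≥ |ξ| - n > 4/3`, decay (12)
      rw [not_le] at hcase
      have hd43 : 4 / 3 ≤ d := by rw [hT] at hcase; linarith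
      have hpos : 0 < ‖triPoint k'.1‖ - n := by rw [hT] at hcase; linarith
      refine (hV.abs_apply_le' hd43).trans ?_
      have h1 : d⁻¹ ≤ (‖triPoint k'.1‖ - n)⁻¹ := inv_anti₀ hpos hd_ge
      have h2 : d⁻¹ ^ 5 ≤ (‖triPoint k'.1‖ - n)⁻¹ ^ 5 :=
        pow_le_pow_left₀ (inv_nonneg.2 hd0) h1 5
      exact mul_le_mul_of_nonneg_left h2 hα

/-- `E(𝒜', {·})` is a continuous function of the free data (continuous admissible `V`).
[cite: Theil2006, §3 Proof of Corollary 1.3 («the minimizer of E(·,·)», preprint p. 14); our lemma] -/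
theorem continuous_relaxedDirichletEnergy_clampedExtend (hV : IsAdmissible α V)
    (hVc : ContinuousOn V (Ici 0)) (A A' : Finset (ℤ × ℤ)) :
    Continuous fun u : A → Plane => relaxedDirichletEnergy V A A' (clampedExtend A u) := by
  have hrow : ∀ k, (fun u : A → Plane => ∑' k' : {k' : ℤ × ℤ // k' ∉ A},
      V (dist (clampedExtend A u k) (clampedExtend A u k'.1))) =
      (fun p => ∑' k' : {k' : ℤ × ℤ // k' ∉ A}, V (dist p (triPoint k'.1))) ∘
        fun u => clampedExtend A u k := by
    intro k
    funext u
    exact tsum_congr fun k' => by rw [clampedExtend_of_not_mem u k'.2]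
  unfold relaxedDirichletEnergy
  refine Continuous.add (Continuous.div_const (continuous_finsetSum _ fun k _ =>
    continuous_finsetSum _ fun k' _ => ?_) _) (continuous_finsetSum _ fun k _ => ?_)
  · exact hVc.comp_continuous ((continuous_clampedExtend_apply A k).dist
      (continuous_clampedExtend_apply A k')) fun u => dist_nonneg
  · rw [hrow k]
    exact (continuous_clampedRow hV hVc A).comp (continuous_clampedExtend_apply A k)

/-- **Minimizers for fixed `𝒜'` on a box**: for continuous admissible `V`, `E(𝒜', {·})` attains
its infimum over the free data in the compact box `{|u(x)| ≤ R}^𝒜`.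
[cite: Theil2006, §3 Proof of Corollary 1.3 («the minimizer of E(·,·)», preprint p. 14); our lemma] -/
theorem exists_isMinOn_relaxedDirichletEnergy (hV : IsAdmissible α V)
    (hVc : ContinuousOn V (Ici 0)) (A A' : Finset (ℤ × ℤ)) {R : ℝ} (hR : 0 ≤ R) :
    ∃ u₀ : A → Plane, (∀ a, ‖u₀ a‖ ≤ R) ∧ ∀ u : A → Plane, (∀ a, ‖u a‖ ≤ R) →
      relaxedDirichletEnergy V A A' (clampedExtend A u₀) ≤
        relaxedDirichletEnergy V A A' (clampedExtend A u) := by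
  set K : Set (A → Plane) := Set.pi univ fun _ => Metric.closedBall (0 : Plane) R with hK
  have hKc : IsCompact K := isCompact_univ_pi fun _ => isCompact_closedBall _ _
  have hKne : K.Nonempty := ⟨0, fun a _ => by simp [Metric.mem_closedBall, hR]⟩
  obtain ⟨u₀, hu₀K, hmin⟩ := hKc.exists_isMinOn hKne
    (continuous_relaxedDirichletEnergy_clampedExtend hV hVc A A').continuousOn
  refine ⟨u₀, fun a => ?_, fun u hu => hmin fun a _ => ?_⟩
  · have := hu₀K a (mem_univ a)
    simpa [Metric.mem_closedBall] using this
  · simpa [Metric.mem_closedBall] using hu a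

/-- **Removal confines the free particles.** For `0 < α < 1/13447168`, admissible `V`,
`𝒜' ⊆ 𝒜` and `y ∈ Y_𝒜^Dir` there is `𝒜'' ⊆ 𝒜'` with `E(𝒜'', {y}) ≤ E(𝒜', {y})` all of whose
particles lie within distance `1` of `𝒜`: a free particle farther away is within `9/10 ≤ 1 − α`
of a clamped lattice site (`exists_dist_triPoint_le`), so `exists_relaxedDirichletEnergy_lt`
removes particles with profit; iterate. [cite: Theil2006, §3 Proof of Corollary 1.3 (preprint p. 14); our lemma] -/
theorem exists_subset_confined (hα : 0 < α) (hαlt : α < 1 / 13447168) (hV : IsAdmissible α V)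
    (hy : IsClampedOutside A y) (hA' : A' ⊆ A) :
    ∃ A'' : Finset (ℤ × ℤ), A'' ⊆ A' ∧
      relaxedDirichletEnergy V A A'' y ≤ relaxedDirichletEnergy V A A' y ∧
        ∀ x ∈ A'', ∃ a ∈ A, dist (y x) (triPoint a) ≤ 1 := by
  have key : ∀ (n : ℕ) (A' : Finset (ℤ × ℤ)), A' ⊆ A → A'.card ≤ n →
      ∃ A'' : Finset (ℤ × ℤ), A'' ⊆ A' ∧
        relaxedDirichletEnergy V A A'' y ≤ relaxedDirichletEnergy V A A' y ∧
          ∀ x ∈ A'', ∃ a ∈ A, dist (y x) (triPoint a) ≤ 1 := by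
    intro n
    induction n with
    | zero =>
      intro A' _ hcard
      refine ⟨A', Finset.Subset.refl _, le_rfl, fun x hx => ?_⟩
      rw [Nat.le_zero, Finset.card_eq_zero] at hcard
      simp [hcard] at hx
    | succ n ih =>
      intro A' hA' hcard
      by_cases hconf : ∀ x ∈ A', ∃ a ∈ A, dist (y x) (triPoint a) ≤ 1
      · exact ⟨A', Finset.Subset.refl _, le_rfl, hconf⟩
      · push Not at hconf
        obtain ⟨x, hxA', hx⟩ := hconf
        obtain ⟨a₀, ha₀⟩ := exists_dist_triPoint_le (y x)
        have ha₀A : a₀ ∉ A := fun h => by linarith [hx a₀ h]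
        have hne : x ≠ a₀ := fun h => ha₀A (h ▸ hA' hxA')
        have hclose : dist (y x) (y a₀) ≤ 1 - α := by
          rw [hy a₀ ha₀A]; linarith
        obtain ⟨A₃, hsub, hne', hlt⟩ :=
          exists_relaxedDirichletEnergy_lt hα hαlt hV hy (Or.inr hxA') (Or.inl ha₀A) hne hclose
        have hcard' : (A' \ A₃).card ≤ n := by
          rw [Finset.card_sdiff_of_subset hsub]
          have hpos := Finset.card_pos.2 hne'
          have := Finset.card_le_card hsub
          omega
        obtain ⟨A'', hA''sub, hle, hconf'⟩ :=
          ih (A' \ A₃) (Finset.sdiff_subset.trans hA') hcard'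
        exact ⟨A'', hA''sub.trans Finset.sdiff_subset, hle.trans hlt.le, hconf'⟩
  exact key A'.card A' hA' le_rfl

/-- **Existence of "the minimizer of `E(·, ·)`" (p. 14), PROVED for admissible potentials that
are moreover continuous on `[0, ∞)`** (`0 < α < 1/13447168`): by `exists_subset_confined` every
competitor is matched by one whose free particles lie in the compact box of radius
`∑_{a ∈ 𝒜} |a| + 1`, on which `E(𝒜', {·})` is continuous in the free data
(`continuous_relaxedDirichletEnergy_clampedExtend`) for each of the finitely many `𝒜' ⊆ 𝒜`.
(The paper asserts existence without proof; for the real-valued potentials of `Theil2006.lean`,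
which (2)–(3) allow to be discontinuous at `1 − α`, the energy need not be lower semicontinuous,
so for general admissible `V` the assertion stays a hypothesis downstream.)
[cite: Theil2006, §3 Proof of Corollary 1.3 («Let 𝒜_min, y_min be the minimizer of E(·,·)», preprint p. 14)] -/
theorem exists_isRelaxedDirichletMinimizer (hα : 0 < α) (hαlt : α < 1 / 13447168)
    (hV : IsAdmissible α V) (hVc : ContinuousOn V (Ici 0)) (A : Finset (ℤ × ℤ)) :
    ∃ (A' : Finset (ℤ × ℤ)) (y : ℤ × ℤ → Plane), IsRelaxedDirichletMinimizer V A A' y := by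
  classical
  set R : ℝ := ∑ a ∈ A, ‖triPoint a‖ + 1 with hR
  have hsum0 : 0 ≤ ∑ a ∈ A, ‖triPoint a‖ := Finset.sum_nonneg fun a _ => norm_nonneg _
  have hR0 : 0 ≤ R := by rw [hR]; linarith
  have hRa : ∀ a ∈ A, ‖triPoint a‖ + 1 ≤ R := fun a ha => by
    rw [hR]
    linarith [Finset.single_le_sum (f := fun a => ‖triPoint a‖) (fun a _ => norm_nonneg _) ha]
  -- minimizers on the box, for each `𝒜'`
  choose u₀ hu₀R hu₀ using fun A' : Finset (ℤ × ℤ) =>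
    exists_isMinOn_relaxedDirichletEnergy hV hVc A A' hR0
  obtain ⟨A₀, hA₀, hA₀min⟩ := Finset.exists_min_image A.powerset
    (fun A' => relaxedDirichletEnergy V A A' (clampedExtend A (u₀ A')))
    ⟨∅, Finset.empty_mem_powerset A⟩
  refine ⟨A₀, clampedExtend A (u₀ A₀), Finset.mem_powerset.1 hA₀, isClampedOutside_clampedExtend _,
    fun A' y' hA' hy' => ?_⟩
  -- confine the competitor, then compare on the box
  obtain ⟨A'', hA''sub, hle, hconf⟩ := exists_subset_confined hα hαlt hV hy' hA'
  set u : A → Plane := fun a => if (a : ℤ × ℤ) ∈ A'' then y' a else 0 with hu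
  have huR : ∀ a, ‖u a‖ ≤ R := by
    intro a
    simp only [hu]
    split_ifs with ha
    · obtain ⟨a₁, ha₁, hd⟩ := hconf a ha
      calc ‖y' a‖ ≤ ‖triPoint a₁‖ + ‖y' a - triPoint a₁‖ := norm_le_insert' _ _
        _ ≤ ‖triPoint a₁‖ + 1 := by rw [← dist_eq_norm]; linarith
        _ ≤ R := hRa a₁ ha₁
    · rw [norm_zero]; exact hR0
  have hagree : relaxedDirichletEnergy V A A'' (clampedExtend A u) =
      relaxedDirichletEnergy V A A'' y' := by
    refine relaxedDirichletEnergy_congr (fun k hk => ?_) (fun k hk => ?_)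
    · have hkA : k ∈ A := hA' (hA''sub hk)
      rw [clampedExtend_of_mem u hkA]
      simp [hu, hk]
    · rw [clampedExtend_of_not_mem u hk, hy' k hk]
  calc relaxedDirichletEnergy V A A₀ (clampedExtend A (u₀ A₀))
      ≤ relaxedDirichletEnergy V A A'' (clampedExtend A (u₀ A'')) :=
        hA₀min A'' (Finset.mem_powerset.2 (hA''sub.trans hA'))
    _ ≤ relaxedDirichletEnergy V A A'' (clampedExtend A u) := hu₀ A'' u huR
    _ = relaxedDirichletEnergy V A A'' y' := hagree
    _ ≤ relaxedDirichletEnergy V A A' y' := hle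

/-- For continuous admissible `V` the relaxed Dirichlet problem has a minimizer, and it satisfies
(13) — the first paragraph of the proof of Corollary 1.3 in full.
[cite: Theil2006, §3 Proof of Corollary 1.3 (preprint p. 14)] -/
theorem exists_isRelaxedDirichletMinimizer_lt_dist (hα : 0 < α) (hαlt : α < 1 / 13447168)
    (hV : IsAdmissible α V) (hVc : ContinuousOn V (Ici 0)) (A : Finset (ℤ × ℤ)) :
    ∃ (A' : Finset (ℤ × ℤ)) (y : ℤ × ℤ → Plane), IsRelaxedDirichletMinimizer V A A' y ∧
      ∀ x, (x ∉ A ∨ x ∈ A') → ∀ x', (x' ∉ A ∨ x' ∈ A') → x ≠ x' → 1 - α < dist (y x) (y x') := by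
  obtain ⟨A', y, h⟩ := exists_isRelaxedDirichletMinimizer hα hαlt hV hVc A
  exact ⟨A', y, h, fun _x hx _x' hx' hne => h.lt_dist hα hαlt hV hx hx' hne⟩

end Existence

end Theil2006

end Literature.MathematicalPhysics.StatisticalMechanics

end
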